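import Summits.RiemannHypothesis.RiemannHypothesis.Theorems.HandoffSemilocalContinuity
import Summits.RiemannHypothesis.RiemannHypothesis.Theorems.GroundBartaPolarPerronFrobeniusEvenSectorNegativity
import Summits.RiemannHypothesis.RiemannHypothesis.Theorems.OddSectorOddNegativityOffLine
import HarnessLib

/-!
# HANDOFF — ONE SECTOR DECIDES: the even halves (or the odd halves) of the handoff inequalities are by themselves equivalent to RH (cell rh-explicit, TRACK «HANDOFF», seat theory-2 gen8, file XII-s)

HONEST FRAMING. Nothing here bears on the truth of RH; every statement is a REFORMULATION (both directions kernel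
theorems) or an RH-free bookkeeping fact. No certificate is proved.

The track's typed target is `RH ↔ ∀ q prime, H(q)` (`HandoffDecomposition.riemannHypothesis_iff_forall_handoffH`), and
`H(q)` is the PAIR of sector inequalities at the window's right end, `H(q) ↔ H_ev(q) ∧ H_od(q)` with
`H_ev(q) :≡ 0 ≤ ε_ev((log q⁺)/2)`, `H_od(q) :≡ 0 ≤ ε_od((log q⁺)/2)` (spelled out below, no new definition; the A1/A4 ladder
certifies exactly such pairs). Prime by prime `H_ev(q)` is HALF of `H(q)`; GLOBALLY one half is enough:
* §3/§4 **`RH ↔ ∀ q prime, H_ev(q) ↔ ∀ q prime, H_od(q)`** (`riemannHypothesis_iff_forall_even/odd`,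
  `forall_handoffH_iff_forall_even/odd`, `forall_even_iff_forall_odd`; the even FAMILY gives every full `H(q)`:
  `handoffH_of_forall_even`); infinitely many halves suffice and a tail suffices (`…_iff_frequently_even/odd`,
  `…_iff_eventually_even/odd`), and under `¬RH` each sector fails at EVERY large prime
  (`eventually_even/odd_neg_of_not_riemannHypothesis`) — the T3 barrier question of RH-PROMISE § 0′ has the same answer in
  each sector: an «`H_ev(q)` for all `q ≥ Q₀`» theorem is RH itself.
* §5 EVEN LADDER RULE: one certificate `0 ≤ ε_ev(c)` gives `H_ev(q)` for every prime `q` with `(log q⁺)/2 ≤ c`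
  (`forall_even_of_even_energy`): the even-only ladder is read off the SAME certified cells as the two-sector ladder and
  reaches at least as far (today further: at `c = 17/10`, `7/4` the even cells are custodian-VERIFIED, the odd ones
  producer-CLAIMED — DATA, HOME/handoff/theory-2/ladder/).
* §6 WALL FORM: **`RH ↔` every EVEN wall offset is positive** — for every prime `q` the even sector of the deleted form
  `Q_{S_q}`, `S_q = {p < q}`, stays `≥ 0` somewhat beyond the entrance point `(log q)/2`
  (`riemannHypothesis_iff_forall_evenWall_pos`; odd twin `…_oddWall_pos`).

WHY TYPE IT (RH-PROMISE Route 1′ / STRUCTURE; the numbers are the cell's DATA, used in no proof): at a handoff «odd carries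
the wall, even carries the margin» — the odd wall offset IS `δ*(q)` (MARGIN-LAW's object), the even wall sits ≈ 3.2× further
out (EDGESIGN REPORT §3b: δ_ev/δ* = 3.0–3.5 for q = 5…23; 2.8–3.1 CERTIFIED at q = 37) and an even negative witness must carry
a NODE in the edge layer (`HandoffEntranceSignLayer`, `HandoffMirrorPolarization`; at (log q)/2 + δ/4, cc-s2-5). By §3/§6
EITHER family is an RH-equivalent target on its own: odd = the binding inequalities (smallest margins, node-free witnesses),
even = three times the margin and a forced node — logically interchangeable, structurally not.

INPUTS (tree theorems): Yoshida's parity criteria as landed Summit-side, `PolarPerronFrobenius.evenNegativity_exists_even_real_neg`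
(GroundBarta, from `RuelleBandExactFirstBand.riemannHypothesis_iff_evenWeilPositivity`) and
`oddNegativityOffLine_exists_odd_real_neg` (OddSector, from `stub_oddSectorCriterion`): if RH fails some EVEN (resp. ODD)
real test has `Re Q < 0`; `weilEvenGroundEnergy`/`weilOddGroundEnergy` (Literature `WeilGroundEnergyParitySplit`);
`HandoffDecomposition` (`HandoffH q`, `nextPrime`), `HandoffSemilocalEnergy` (`semilocalGroundEnergy S P a`, locality),
`HandoffSemilocalContinuity` (`wallOffset_pos_of_riemannHypothesis`). (Three small facts — `0 < (log q⁺)/2`, `q ≤ Q → q⁺ ≤ Q⁺`,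
`λ_min(S;a) ≤ λ_min(S;a;P)` — exist as `HandoffMarginLaw.log_nextPrime_half_pos`, `HandoffLadderRungsWide.nextPrime_le_nextPrime`,
`HandoffSemilocalParitySplit.semilocalGroundEnergy_top_le`; they are re-derived inline as `have`s to keep this file's import closure
inside modules the farm has built.)
References: H. Yoshida, Adv. Stud. Pure Math. 21 (1992) Prop. 1 ((1) odd criterion, (2) even criterion — real-zero clause void for ζ; pp. 285–286), Prop. 6 (p. 320)
[Yoshida1992HermitianForms]; E. Bombieri, Rend. Mat. Acc. Lincei (9) 11 (2000) §4 Thm 5 (μ±(M) decreasing), §5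
[Bombieri2000Weil]; A. Connes, C. Consani, Enseign. Math. 69 (2023) §2.1.3 (even/odd splitting) [ConnesConsani2023].
-/

set_option linter.dupNamespace false

noncomputable section

open Set Filter MeasureTheory Literature.NumberTheory.LFunctions
open Summit.RiemannHypothesis.RiemannHypothesis.Theorems.HandoffDecomposition
open Summit.RiemannHypothesis.RiemannHypothesis.Theorems.HandoffSemilocalEnergy
open Summit.RiemannHypothesis.RiemannHypothesis.Theorems.MotivicDoor.SemilocalThreshold
open Summit.RiemannHypothesis.RiemannHypothesis.Theorems.MotivicDoor.Semilocal
open scoped Real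

namespace Summit.RiemannHypothesis.RiemannHypothesis.Theorems.HandoffSectorCriterion

variable {q Q : ℕ} {a b c : ℝ}

/-! ## §1 Per prime: `H(q)` is the pair of sector inequalities at `(log q⁺)/2` -/

/-- **`H(q) ↔ H_ev(q) ∧ H_od(q)`**: the handoff inequality of the prime `q` is the pair `0 ≤ ε_ev((log q⁺)/2)`,
`0 ≤ ε_od((log q⁺)/2)` (parity split of the window bottom, `ε = min(ε_ev, ε_od)`).
[cite: Yoshida1992HermitianForms, §2 p. 287 and Prop. 6 (p. 320); ConnesConsani2023 §2.1.3] -/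
theorem handoffH_iff_even_and_odd (hq : q.Prime) :
    HandoffH q ↔ 0 ≤ weilEvenGroundEnergy (Real.log (nextPrime q) / 2) ∧
      0 ≤ weilOddGroundEnergy (Real.log (nextPrime q) / 2) := by
  have hpos : 0 < Real.log (nextPrime q) / 2 := by
    have := Real.log_pos (show (1 : ℝ) < nextPrime q by exact_mod_cast (nextPrime_prime q).one_lt); positivity
  rw [handoffH_iff_weilPositivityOn hq, ← weilGroundEnergy_nonneg_iff_holds hpos, weilGroundEnergy_eq_min_even_odd,
    le_min_iff]

/-- The even half of `H(q)`. [folklore] -/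
theorem even_nonneg_of_handoffH (hq : q.Prime) (h : HandoffH q) :
    0 ≤ weilEvenGroundEnergy (Real.log (nextPrime q) / 2) :=
  ((handoffH_iff_even_and_odd hq).1 h).1

/-- The odd half of `H(q)`. [folklore] -/
theorem odd_nonneg_of_handoffH (hq : q.Prime) (h : HandoffH q) :
    0 ≤ weilOddGroundEnergy (Real.log (nextPrime q) / 2) :=
  ((handoffH_iff_even_and_odd hq).1 h).2

/-- Under RH every even half holds (via `H(q)`). [cite: Yoshida1992HermitianForms, Prop. 1 ("if" part)] -/
theorem even_nonneg_of_riemannHypothesis (hRH : Summit.RiemannHypothesis) (hq : q.Prime) :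
    0 ≤ weilEvenGroundEnergy (Real.log (nextPrime q) / 2) :=
  even_nonneg_of_handoffH hq (handoffH_of_riemannHypothesis hRH hq)

/-- Under RH every odd half holds. [cite: Yoshida1992HermitianForms, Prop. 1 ("if" part)] -/
theorem odd_nonneg_of_riemannHypothesis (hRH : Summit.RiemannHypothesis) (hq : q.Prime) :
    0 ≤ weilOddGroundEnergy (Real.log (nextPrime q) / 2) :=
  odd_nonneg_of_handoffH hq (handoffH_of_riemannHypothesis hRH hq)

/-! ## §2 Heights: every height lies below the window end of some prime, and below all later ones -/

/-- `(log q)/2 ≤ (log q⁺)/2` (`q` prime). [folklore] -/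
theorem log_half_le_log_nextPrime_half (hq : q.Prime) : Real.log q / 2 ≤ Real.log (nextPrime q) / 2 := by
  have h0 : (0 : ℝ) < q := by exact_mod_cast hq.pos
  have h1 : (q : ℝ) ≤ nextPrime q := by exact_mod_cast (lt_nextPrime q).le
  linarith [Real.log_le_log h0 h1]

/-- Window ends are monotone along the primes: `q ≤ Q` ⟹ `(log q⁺)/2 ≤ (log Q⁺)/2`. [folklore] -/
theorem log_nextPrime_half_mono (hQ : Q.Prime) (hqQ : q ≤ Q) :
    Real.log (nextPrime q) / 2 ≤ Real.log (nextPrime Q) / 2 := by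
  have h0 : (0 : ℝ) < nextPrime q := by exact_mod_cast (nextPrime_prime q).pos
  have hmono : nextPrime q ≤ nextPrime Q := by
    rcases hqQ.eq_or_lt with rfl | hlt
    · exact le_rfl
    · exact (nextPrime_le hQ hlt).trans (lt_nextPrime Q).le
  have h1 : (nextPrime q : ℝ) ≤ nextPrime Q := by exact_mod_cast hmono
  linarith [Real.log_le_log h0 h1]

/-- For every height `A` and every `N` there is a prime `q ≥ N` with `A ≤ (log q)/2` (hence `A ≤ (log q⁺)/2`).
[folklore] -/
theorem exists_prime_ge_height (A : ℝ) (N : ℕ) :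
    ∃ q : ℕ, N ≤ q ∧ q.Prime ∧ A ≤ Real.log q / 2 ∧ A ≤ Real.log (nextPrime q) / 2 := by
  obtain ⟨q, hq, hqp⟩ := Nat.exists_infinite_primes (max N ⌈Real.exp (2 * A)⌉₊)
  have hN : N ≤ q := (le_max_left _ _).trans hq
  have hexp : Real.exp (2 * A) ≤ q := by
    have h1 : (⌈Real.exp (2 * A)⌉₊ : ℝ) ≤ q := by exact_mod_cast (le_max_right _ _).trans hq
    exact (Nat.le_ceil _).trans h1
  have hlog : 2 * A ≤ Real.log q := by
    have := Real.log_le_log (Real.exp_pos _) hexp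
    rwa [Real.log_exp] at this
  have hA : A ≤ Real.log q / 2 := by linarith
  exact ⟨q, hN, hqp, hA, hA.trans (log_half_le_log_nextPrime_half hqp)⟩

/-! ## §3 RH ↔ all even halves; RH ↔ all odd halves -/

/-- An even (resp. any) test supported in `[−A, A]` with `Re Q(g) < 0` makes `ε_ev(a) < 0` for every `a ≥ A`
(homogeneous Ritz bound `ε_ev(a)·‖g‖₂² ≤ Re Q(g)`). [folklore] -/
theorem weilEvenGroundEnergy_neg_of_witness {g : ℝ → ℂ} (hg : IsWeilTest g) (hs : tsupport g ⊆ Icc (-a) a)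
    (hev : ∀ t, g (-t) = g t) (hneg : (weilQuadratic g).re < 0) : weilEvenGroundEnergy a < 0 := by
  by_contra h
  push Not at h
  have hN : 0 ≤ ∫ t : ℝ, ‖g t‖ ^ 2 := integral_nonneg fun _ ↦ by positivity
  have h1 := weilEvenGroundEnergy_mul_le_re hg hs hev
  have h2 : 0 ≤ weilEvenGroundEnergy a * ∫ t : ℝ, ‖g t‖ ^ 2 := mul_nonneg h hN
  linarith

/-- Odd twin of `weilEvenGroundEnergy_neg_of_witness`. [folklore] -/
theorem weilOddGroundEnergy_neg_of_witness {g : ℝ → ℂ} (hg : IsWeilTest g) (hs : tsupport g ⊆ Icc (-a) a)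
    (hod : ∀ t, g (-t) = -g t) (hneg : (weilQuadratic g).re < 0) : weilOddGroundEnergy a < 0 := by
  by_contra h
  push Not at h
  have hN : 0 ≤ ∫ t : ℝ, ‖g t‖ ^ 2 := integral_nonneg fun _ ↦ by positivity
  have h1 := weilOddGroundEnergy_mul_le_re hg hs hod
  have h2 : 0 ≤ weilOddGroundEnergy a * ∫ t : ℝ, ‖g t‖ ^ 2 := mul_nonneg h hN
  linarith

/-- **`¬RH` ⟹ the EVEN halves fail at every large prime**: there is `N` with `ε_ev((log q⁺)/2) < 0` for every prime
`q ≥ N` (the even negative witness of `PolarPerronFrobenius.evenNegativity_exists_even_real_neg` lives on some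
`[−A, A]`; every later window contains it). [cite: Yoshida1992HermitianForms, Prop. 1 (2), "only if" part (real-zero clause void for ζ)] -/
theorem eventually_even_neg_of_not_riemannHypothesis (hRH : ¬ Summit.RiemannHypothesis) :
    ∃ N : ℕ, ∀ q : ℕ, N ≤ q → q.Prime → weilEvenGroundEnergy (Real.log (nextPrime q) / 2) < 0 := by
  rw [Summit.RiemannHypothesis_iff] at hRH
  obtain ⟨g, hg, hev, -, hneg⟩ := PolarPerronFrobenius.evenNegativity_exists_even_real_neg hRH
  obtain ⟨A, -, hs⟩ := hg.exists_tsupport_subset_Icc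
  obtain ⟨N, -, hN, hAN, -⟩ := exists_prime_ge_height A 0
  refine ⟨N, fun q hNq hq ↦ weilEvenGroundEnergy_neg_of_witness hg (hs.trans ?_) hev hneg⟩
  have : A ≤ Real.log (nextPrime q) / 2 :=
    (hAN.trans (log_half_le_log_nextPrime_half hN)).trans (log_nextPrime_half_mono hq hNq)
  exact Icc_subset_Icc (neg_le_neg this) this

/-- **`¬RH` ⟹ the ODD halves fail at every large prime** (`oddNegativityOffLine_exists_odd_real_neg`).
[cite: Yoshida1992HermitianForms, Prop. 1(1), "only if" part] -/
theorem eventually_odd_neg_of_not_riemannHypothesis (hRH : ¬ Summit.RiemannHypothesis) :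
    ∃ N : ℕ, ∀ q : ℕ, N ≤ q → q.Prime → weilOddGroundEnergy (Real.log (nextPrime q) / 2) < 0 := by
  rw [Summit.RiemannHypothesis_iff] at hRH
  obtain ⟨g, hg, hod, -, hneg⟩ := oddNegativityOffLine_exists_odd_real_neg hRH
  obtain ⟨A, -, hs⟩ := hg.exists_tsupport_subset_Icc
  obtain ⟨N, -, hN, hAN, -⟩ := exists_prime_ge_height A 0
  refine ⟨N, fun q hNq hq ↦ weilOddGroundEnergy_neg_of_witness hg (hs.trans ?_) hod hneg⟩
  have : A ≤ Real.log (nextPrime q) / 2 :=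
    (hAN.trans (log_half_le_log_nextPrime_half hN)).trans (log_nextPrime_half_mono hq hNq)
  exact Icc_subset_Icc (neg_le_neg this) this

/-- **`RH ↔ H_ev(q)` FOR INFINITELY MANY PRIMES `q`** (even halves at unboundedly many primes already give RH).
[cite: Yoshida1992HermitianForms, Prop. 1 (2) (even criterion)] -/
theorem riemannHypothesis_iff_frequently_even :
    Summit.RiemannHypothesis ↔
      ∀ N : ℕ, ∃ q : ℕ, N ≤ q ∧ q.Prime ∧ 0 ≤ weilEvenGroundEnergy (Real.log (nextPrime q) / 2) := by
  refine ⟨fun hRH N ↦ ?_, fun h ↦ ?_⟩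
  · obtain ⟨q, hNq, hq, -, -⟩ := exists_prime_ge_height 0 N
    exact ⟨q, hNq, hq, even_nonneg_of_riemannHypothesis hRH hq⟩
  · by_contra hRH
    obtain ⟨N, hN⟩ := eventually_even_neg_of_not_riemannHypothesis hRH
    obtain ⟨q, hNq, hq, hpos⟩ := h N
    exact absurd hpos (not_le.2 (hN q hNq hq))

/-- **`RH ↔ H_od(q)` FOR INFINITELY MANY PRIMES `q`.** [cite: Yoshida1992HermitianForms, Prop. 1(1) (odd criterion)] -/
theorem riemannHypothesis_iff_frequently_odd :
    Summit.RiemannHypothesis ↔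
      ∀ N : ℕ, ∃ q : ℕ, N ≤ q ∧ q.Prime ∧ 0 ≤ weilOddGroundEnergy (Real.log (nextPrime q) / 2) := by
  refine ⟨fun hRH N ↦ ?_, fun h ↦ ?_⟩
  · obtain ⟨q, hNq, hq, -, -⟩ := exists_prime_ge_height 0 N
    exact ⟨q, hNq, hq, odd_nonneg_of_riemannHypothesis hRH hq⟩
  · by_contra hRH
    obtain ⟨N, hN⟩ := eventually_odd_neg_of_not_riemannHypothesis hRH
    obtain ⟨q, hNq, hq, hpos⟩ := h N
    exact absurd hpos (not_le.2 (hN q hNq hq))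

/-- **`RH ↔ ∀ q prime, H_ev(q)`** — the EVEN halves of the handoff inequalities are, as a family, equivalent to RH.
[cite: Yoshida1992HermitianForms, Prop. 1 (2) (even criterion) and Prop. 6 (p. 320)] -/
theorem riemannHypothesis_iff_forall_even :
    Summit.RiemannHypothesis ↔ ∀ q : ℕ, q.Prime → 0 ≤ weilEvenGroundEnergy (Real.log (nextPrime q) / 2) := by
  refine ⟨fun hRH q hq ↦ even_nonneg_of_riemannHypothesis hRH hq, fun h ↦ ?_⟩
  refine riemannHypothesis_iff_frequently_even.2 fun N ↦ ?_
  obtain ⟨q, hNq, hq, -, -⟩ := exists_prime_ge_height 0 N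
  exact ⟨q, hNq, hq, h q hq⟩

/-- **`RH ↔ ∀ q prime, H_od(q)`** — the ODD halves are, as a family, equivalent to RH.
[cite: Yoshida1992HermitianForms, Prop. 1(1) (odd criterion) and Prop. 6 (p. 320)] -/
theorem riemannHypothesis_iff_forall_odd :
    Summit.RiemannHypothesis ↔ ∀ q : ℕ, q.Prime → 0 ≤ weilOddGroundEnergy (Real.log (nextPrime q) / 2) := by
  refine ⟨fun hRH q hq ↦ odd_nonneg_of_riemannHypothesis hRH hq, fun h ↦ ?_⟩
  refine riemannHypothesis_iff_frequently_odd.2 fun N ↦ ?_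
  obtain ⟨q, hNq, hq, -, -⟩ := exists_prime_ge_height 0 N
  exact ⟨q, hNq, hq, h q hq⟩

/-- **A TAIL OF EVEN HALVES IS RH**: `RH ↔ ∃ N, ∀ primes q ≥ N, H_ev(q)` — the barrier question T3 of RH-PROMISE § 0′
in the even sector: an «eventually `H_ev`» theorem is RH itself. [cite: Yoshida1992HermitianForms, Prop. 1] -/
theorem riemannHypothesis_iff_eventually_even :
    Summit.RiemannHypothesis ↔
      ∃ N : ℕ, ∀ q : ℕ, N ≤ q → q.Prime → 0 ≤ weilEvenGroundEnergy (Real.log (nextPrime q) / 2) := by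
  refine ⟨fun hRH ↦ ⟨0, fun q _ hq ↦ even_nonneg_of_riemannHypothesis hRH hq⟩, fun ⟨N, h⟩ ↦ ?_⟩
  refine riemannHypothesis_iff_frequently_even.2 fun M ↦ ?_
  obtain ⟨q, hMq, hq, -, -⟩ := exists_prime_ge_height 0 (max N M)
  exact ⟨q, (le_max_right _ _).trans hMq, hq, h q ((le_max_left _ _).trans hMq) hq⟩

/-- **A TAIL OF ODD HALVES IS RH.** [cite: Yoshida1992HermitianForms, Prop. 1(1)] -/
theorem riemannHypothesis_iff_eventually_odd :
    Summit.RiemannHypothesis ↔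
      ∃ N : ℕ, ∀ q : ℕ, N ≤ q → q.Prime → 0 ≤ weilOddGroundEnergy (Real.log (nextPrime q) / 2) := by
  refine ⟨fun hRH ↦ ⟨0, fun q _ hq ↦ odd_nonneg_of_riemannHypothesis hRH hq⟩, fun ⟨N, h⟩ ↦ ?_⟩
  refine riemannHypothesis_iff_frequently_odd.2 fun M ↦ ?_
  obtain ⟨q, hMq, hq, -, -⟩ := exists_prime_ge_height 0 (max N M)
  exact ⟨q, (le_max_right _ _).trans hMq, hq, h q ((le_max_left _ _).trans hMq) hq⟩

/-- **The even family implies every FULL handoff inequality** (through RH): `(∀ p prime, H_ev(p)) → H(q)`.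
[cite: Yoshida1992HermitianForms, Prop. 1 and Prop. 6] -/
theorem handoffH_of_forall_even (h : ∀ p : ℕ, p.Prime → 0 ≤ weilEvenGroundEnergy (Real.log (nextPrime p) / 2))
    (hq : q.Prime) : HandoffH q :=
  handoffH_of_riemannHypothesis (riemannHypothesis_iff_forall_even.2 h) hq

/-- **The odd family implies every FULL handoff inequality.** [cite: Yoshida1992HermitianForms, Prop. 1(1) and Prop. 6] -/
theorem handoffH_of_forall_odd (h : ∀ p : ℕ, p.Prime → 0 ≤ weilOddGroundEnergy (Real.log (nextPrime p) / 2))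
    (hq : q.Prime) : HandoffH q :=
  handoffH_of_riemannHypothesis (riemannHypothesis_iff_forall_odd.2 h) hq

/-- `(∀ q, H(q)) ↔ (∀ q, H_ev(q))`: the two-sector family and the even family are the same statement.
[cite: Yoshida1992HermitianForms, Prop. 1, Prop. 6] -/
theorem forall_handoffH_iff_forall_even :
    (∀ q : ℕ, q.Prime → HandoffH q) ↔ ∀ q : ℕ, q.Prime → 0 ≤ weilEvenGroundEnergy (Real.log (nextPrime q) / 2) := by
  rw [← riemannHypothesis_iff_forall_handoffH, riemannHypothesis_iff_forall_even]

/-- `(∀ q, H(q)) ↔ (∀ q, H_od(q))`. [cite: Yoshida1992HermitianForms, Prop. 1(1), Prop. 6] -/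
theorem forall_handoffH_iff_forall_odd :
    (∀ q : ℕ, q.Prime → HandoffH q) ↔ ∀ q : ℕ, q.Prime → 0 ≤ weilOddGroundEnergy (Real.log (nextPrime q) / 2) := by
  rw [← riemannHypothesis_iff_forall_handoffH, riemannHypothesis_iff_forall_odd]

/-- **The even family and the odd family are equivalent** (each is RH) — though prime by prime the two halves are
logically independent statements about different cones. [cite: Yoshida1992HermitianForms, Prop. 1] -/
theorem forall_even_iff_forall_odd :
    (∀ q : ℕ, q.Prime → 0 ≤ weilEvenGroundEnergy (Real.log (nextPrime q) / 2)) ↔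
      ∀ q : ℕ, q.Prime → 0 ≤ weilOddGroundEnergy (Real.log (nextPrime q) / 2) := by
  rw [← riemannHypothesis_iff_forall_even, riemannHypothesis_iff_forall_odd]

/-! ## §5 The even ladder rule: one even certificate serves every earlier prime -/

/-- **EVEN LADDER RULE**: a single even-sector certificate `0 ≤ ε_ev(c)` at a bandwidth `c ≥ (log Q⁺)/2` gives the even
half `H_ev(q)` for every prime `q ≤ Q` (`ε_ev` is antitone). [cite: Bombieri2000Weil, §4 Thm 5 (p. 199), μ⁺(M) decreasing] -/
theorem forall_even_of_even_energy (hQ : Q.Prime) (hc : Real.log (nextPrime Q) / 2 ≤ c)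
    (hev : 0 ≤ weilEvenGroundEnergy c) :
    ∀ q : ℕ, q.Prime → q ≤ Q → 0 ≤ weilEvenGroundEnergy (Real.log (nextPrime q) / 2) := fun q _ hqQ ↦
  hev.trans (weilEvenGroundEnergy_antitone (by have := Real.log_pos (show (1 : ℝ) < nextPrime q by exact_mod_cast (nextPrime_prime q).one_lt); positivity)
    ((log_nextPrime_half_mono hQ hqQ).trans hc))

/-- **ODD LADDER RULE** (twin). [cite: Bombieri2000Weil, §4 Thm 5 (p. 199), μ⁻(M) decreasing] -/
theorem forall_odd_of_odd_energy (hQ : Q.Prime) (hc : Real.log (nextPrime Q) / 2 ≤ c)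
    (hod : 0 ≤ weilOddGroundEnergy c) :
    ∀ q : ℕ, q.Prime → q ≤ Q → 0 ≤ weilOddGroundEnergy (Real.log (nextPrime q) / 2) := fun q _ hqQ ↦
  hod.trans (weilOddGroundEnergy_antitone (by have := Real.log_pos (show (1 : ℝ) < nextPrime q by exact_mod_cast (nextPrime_prime q).one_lt); positivity)
    ((log_nextPrime_half_mono hQ hqQ).trans hc))

/-! ## §6 Wall form: RH ↔ every EVEN wall offset is positive (and the odd twin) -/

/-- Below the entrance point the deleted form IS the full form, in every sector: for `q` prime, `b ≤ (log q)/2` and any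
constraint `P`, `λ_min(S_q; b; P) = sInf (weilWindowSphereValues P b)` (`S_q = Nat.primesBelow q`; locality — every
prime power `≤ q − 1` has its prime below `q`). [cite: ConnesConsani2023, §2.1.2] -/
theorem semilocalGroundEnergy_old_cone_sector (hq : q.Prime) (P : (ℝ → ℂ) → Prop) (hb : b ≤ Real.log q / 2) :
    semilocalGroundEnergy (Nat.primesBelow q) P b = sInf (weilWindowSphereValues P b) := by
  have hq1 : 1 ≤ q := hq.one_lt.le
  have hcast : ((q - 1 : ℕ) : ℝ) + 1 = q := by
    rw [Nat.cast_sub hq1]; push_cast; ring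
  have hS : ∀ n ≤ q - 1, IsPrimePow n → n.primeFactors ⊆ Nat.primesBelow q := by
    intro n hn _
    have := primeFactors_subset_primesBelow hn
    rwa [Nat.sub_add_cancel hq1] at this
  exact semilocalGroundEnergy_eq_of_forall (N := q - 1) hS (by rwa [hcast])

/-- Even instance: `λ_ev(S_q; b) = ε_ev(b)` for `b ≤ (log q)/2`. [folklore] -/
theorem semilocalEvenEnergy_old_cone (hq : q.Prime) (hb : b ≤ Real.log q / 2) :
    semilocalGroundEnergy (Nat.primesBelow q) (fun g ↦ ∀ t, g (-t) = g t) b = weilEvenGroundEnergy b := by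
  rw [semilocalGroundEnergy_old_cone_sector hq _ hb, weilEvenGroundEnergy_eq_sInf]

/-- Odd instance: `λ_od(S_q; b) = ε_od(b)` for `b ≤ (log q)/2`. [folklore] -/
theorem semilocalOddEnergy_old_cone (hq : q.Prime) (hb : b ≤ Real.log q / 2) :
    semilocalGroundEnergy (Nat.primesBelow q) (fun g ↦ ∀ t, g (-t) = -g t) b = weilOddGroundEnergy b := by
  rw [semilocalGroundEnergy_old_cone_sector hq _ hb, weilOddGroundEnergy_eq_sInf]

/-- Under RH every SECTOR of the deleted form `Q_{S_q}` stays `≥ 0` strictly beyond the entrance point: there is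
`b > (log q)/2` with `0 ≤ λ_min(S_q; b; P)` (every `b < a*(S_q)` does, and `a*(S_q) > (log q)/2` under RH,
`wallOffset_pos_of_riemannHypothesis`; `P` any constraint with nonempty spheres, e.g. a parity).
[cite: Yoshida1992HermitianForms, Thm 2 and Prop. 6; this track (HANDOFF-STATEMENT §B.4)] -/
theorem exists_sectorWall_pos_of_riemannHypothesis (P : (ℝ → ℂ) → Prop)
    (hne : ∀ b : ℝ, 0 < b → (semilocalSphereValues (Nat.primesBelow q) P b).Nonempty)
    (hRH : Summit.RiemannHypothesis) (hq : q.Prime) :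
    ∃ b : ℝ, Real.log q / 2 < b ∧ 0 ≤ semilocalGroundEnergy (Nat.primesBelow q) P b := by
  have hδ := wallOffset_pos_of_riemannHypothesis hRH hq
  unfold HandoffMarginLaw.wallOffset at hδ
  set b : ℝ := (Real.log q / 2 + weilSemilocalThreshold (Nat.primesBelow q)) / 2 with hb
  have hlt : Real.log q / 2 < b := by rw [hb]; linarith
  have hle : b ≤ weilSemilocalThreshold (Nat.primesBelow q) := by rw [hb]; linarith
  have hb0 : 0 < b := by
    have : 0 < Real.log q / 2 := by
      have := Real.log_pos (show (1 : ℝ) < q by exact_mod_cast hq.one_lt); positivity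
    linarith
  have htop : 0 ≤ semilocalGroundEnergy (Nat.primesBelow q) (fun _ ↦ True) b :=
    semilocalGroundEnergy_top_nonneg_iff_le_threshold.2 hle
  refine ⟨b, hlt, htop.trans (csInf_le_csInf (bddBelow_semilocalSphereValues _ _ b) (hne b hb0) ?_)⟩
  rintro x ⟨g, hg, hs, -, hn, rfl⟩
  exact ⟨g, hg, hs, trivial, hn, rfl⟩

/-- Even instance: under RH, `∃ b > (log q)/2, 0 ≤ λ_ev(S_q; b)`. [cite: Yoshida1992HermitianForms, Thm 2, Prop. 6] -/
theorem exists_evenWall_pos_of_riemannHypothesis (hRH : Summit.RiemannHypothesis) (hq : q.Prime) :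
    ∃ b : ℝ, Real.log q / 2 < b ∧
      0 ≤ semilocalGroundEnergy (Nat.primesBelow q) (fun g ↦ ∀ t, g (-t) = g t) b :=
  exists_sectorWall_pos_of_riemannHypothesis _ (fun _ hb ↦ semilocalSphereValues_even_nonempty _ hb) hRH hq

/-- Odd instance: under RH, `∃ b > (log q)/2, 0 ≤ λ_od(S_q; b)`. [cite: Yoshida1992HermitianForms, Thm 2, Prop. 6] -/
theorem exists_oddWall_pos_of_riemannHypothesis (hRH : Summit.RiemannHypothesis) (hq : q.Prime) :
    ∃ b : ℝ, Real.log q / 2 < b ∧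
      0 ≤ semilocalGroundEnergy (Nat.primesBelow q) (fun g ↦ ∀ t, g (-t) = -g t) b :=
  exists_sectorWall_pos_of_riemannHypothesis _ (fun _ hb ↦ semilocalSphereValues_odd_nonempty _ hb) hRH hq

/-- **`RH ↔` EVERY EVEN WALL OFFSET IS POSITIVE**: RH holds iff for every prime `q` the even sector of the deleted form
`Q_{S_q}` (`S_q = {p < q}`) is still `≥ 0` on some window strictly larger than `[−(log q)/2, (log q)/2]` — i.e. the even
wall `a*_ev(S_q)` lies strictly beyond the entrance point of `q`.  (DATA of the cell, not used: it lies ≈ 3.2 odd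
wall-offsets beyond it.)  `←`: an even negative witness of Weil's form (¬RH, Yoshida) lives below `(log q)/2` for all
large `q`, where `Q_{S_q} = Q` in the even sector, and `λ_ev(S_q; ·)` is antitone.
[cite: Yoshida1992HermitianForms, Prop. 1, Thm 2, Prop. 6; Bombieri2000Weil §4 Thm 5] -/
theorem riemannHypothesis_iff_forall_evenWall_pos :
    Summit.RiemannHypothesis ↔ ∀ q : ℕ, q.Prime → ∃ b : ℝ, Real.log q / 2 < b ∧
      0 ≤ semilocalGroundEnergy (Nat.primesBelow q) (fun g ↦ ∀ t, g (-t) = g t) b := by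
  refine ⟨fun hRH q hq ↦ exists_evenWall_pos_of_riemannHypothesis hRH hq, fun h ↦ ?_⟩
  by_contra hRH
  have hRH' : ¬ _root_.RiemannHypothesis := by rwa [Summit.RiemannHypothesis_iff] at hRH
  obtain ⟨g, hg, hev, -, hneg⟩ := PolarPerronFrobenius.evenNegativity_exists_even_real_neg hRH'
  obtain ⟨A, hA0, hs⟩ := hg.exists_tsupport_subset_Icc
  obtain ⟨q, -, hq, hAq, -⟩ := exists_prime_ge_height A 0
  obtain ⟨b, hb, hpos⟩ := h q hq
  -- antitone: 0 ≤ λ_ev(S_q; b) ≤ λ_ev(S_q; A) = ε_ev(A) < 0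
  have hanti := semilocalGroundEnergy_anti (Nat.primesBelow q) (fun g : ℝ → ℂ ↦ ∀ t, g (-t) = g t)
    (semilocalSphereValues_even_nonempty _ hA0) (hAq.trans hb.le)
  have hloc := semilocalEvenEnergy_old_cone hq hAq
  have hwit := weilEvenGroundEnergy_neg_of_witness hg hs hev hneg
  linarith

/-- **`RH ↔` EVERY ODD WALL OFFSET IS POSITIVE** (odd twin; the odd wall is the wall of record, `δ*(q)`, by the
cell's DATA). [cite: Yoshida1992HermitianForms, Prop. 1(1), Thm 2, Prop. 6; Bombieri2000Weil §4 Thm 5] -/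
theorem riemannHypothesis_iff_forall_oddWall_pos :
    Summit.RiemannHypothesis ↔ ∀ q : ℕ, q.Prime → ∃ b : ℝ, Real.log q / 2 < b ∧
      0 ≤ semilocalGroundEnergy (Nat.primesBelow q) (fun g ↦ ∀ t, g (-t) = -g t) b := by
  refine ⟨fun hRH q hq ↦ exists_oddWall_pos_of_riemannHypothesis hRH hq, fun h ↦ ?_⟩
  by_contra hRH
  have hRH' : ¬ _root_.RiemannHypothesis := by rwa [Summit.RiemannHypothesis_iff] at hRH
  obtain ⟨g, hg, hod, -, hneg⟩ := oddNegativityOffLine_exists_odd_real_neg hRH'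
  obtain ⟨A, hA0, hs⟩ := hg.exists_tsupport_subset_Icc
  obtain ⟨q, -, hq, hAq, -⟩ := exists_prime_ge_height A 0
  obtain ⟨b, hb, hpos⟩ := h q hq
  have hanti := semilocalGroundEnergy_anti (Nat.primesBelow q) (fun g : ℝ → ℂ ↦ ∀ t, g (-t) = -g t)
    (semilocalSphereValues_odd_nonempty _ hA0) (hAq.trans hb.le)
  have hloc := semilocalOddEnergy_old_cone hq hAq
  have hwit := weilOddGroundEnergy_neg_of_witness hg hs hod hneg
  linarith

end Summit.RiemannHypothesis.RiemannHypothesis.Theorems.HandoffSectorCriterion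

end
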